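import Summits.RiemannHypothesis.RiemannHypothesis.Theorems.PfPersistenceRatioTransport
import HarnessLib
import Summits.RiemannHypothesis.RiemannHypothesis.Theorems.WeilRouteProps.WeilGroundState
import Summits.RiemannHypothesis.RiemannHypothesis.Theorems.WeilRouteProps.WeilParity

/-!
# PF persistence — the RATIO-BUDGET hypothesis class `RatioBudgetFrom b₀ B` (pub-rhpf, barrier-typer gen 6)

**HONEST FRAMING. This is a long-odds MECHANISM SEARCH; no RH claims.** This file NAMES a hypothesis; it proves
nothing about ζ beyond re-exporting transport-1's conditional theorems (`PfPersistenceRatioTransport`,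
6fdca81f1d52) under the name.

RULING A129, answer to QUESTION A124 (c) (iv) (adj-3 g21): four tree theorems consume the identical binder
`∀ b ≥ 2/3, 0 < ε₋(b) → ε₊(b)·ε₋(2/3) ≤ B·(ε₊(2/3)·ε₋(b))` on the CONTINUUM sector bottoms
(`weilEvenGroundEnergy` = ε₊, `weilOddGroundEnergy` = ε₋, `Literature.NumberTheory.LFunctions`), so by the
A101 (a3) criterion it deserves a typer name as a HYPOTHESIS CLASS — **not a 𝒞 member** (its RH-free
conclusions live on `{b | ε₋(b) > 0}`, and odd positivity for all `b` is RH-strength; A129 (iii)), and every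
truncation `b ≤ A` is finitely many sector values, so its content is the `b → ∞` tail: door E1 by description
(A129 (i), A101 (a1) pattern; no `InG1contU` certificate — the inequality is non-strict, A129 (ii)).

* `RatioBudgetFrom b₀ B : Prop` — the budget from the anchor `b₀` (of record: `b₀ = 2/3`).
* `ratioBudgetFrom_two_thirds_iff` — it IS transport-1's binder (by `Iff.rfl`).
* `RatioBudgetFrom.mono` — monotone in the budget `B` (given `0 ≤ ε₊(b₀)`).
* re-exports: `RatioBudgetFrom.even_lt_odd`, `.odd_nonpos_of_parityTie`, `.parity_of_riemannHypothesis`,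
  `.parity_of_lt_fifty_of_riemannHypothesis` (conditional theorems of 6fdca81f1d52, verbatim).

MEMBERSHIP.md / ESCAPE-DOORS.md cite the class by this name (TR1-RATIO row: 'E1 by description (A129), no 𝒞ᵢ id').
-/

set_option linter.dupNamespace false  -- the mandated namespace repeats `RiemannHypothesis`

noncomputable section

namespace Summit.RiemannHypothesis.RiemannHypothesis.Theorems.PfPersistence

open _root_.Literature.NumberTheory.LFunctions
open _root_.Summit.RiemannHypothesis.RiemannHypothesis.Theorems.WeilRouteProps.WeilParity (NoParityCrossing EvenWinsBeyondArch)
open _root_.Summit.RiemannHypothesis.RiemannHypothesis.Theorems.WeilRouteProps.WeilGroundState (GroundStateSimpleEven)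
open _root_.Summit.RiemannHypothesis.RiemannHypothesis.Theorems.PfPersistenceRatioTransport
  (even_lt_odd_of_ratioBudget odd_nonpos_of_parityTie_of_ratioBudget parity_of_ratioBudget_of_riemannHypothesis
    parity_of_ratioBudget_lt_fifty_of_riemannHypothesis)

/-- HYPOTHESIS CLASS (not a 𝒞 member; E1 by description, A129): the RATIO BUDGET from the anchor `b₀` with
budget `B` — at every `b ≥ b₀` with positive odd bottom, `ε₊(b)·ε₋(b₀) ≤ B·(ε₊(b₀)·ε₋(b))`, i.e. the parity
ratio `ε₊/ε₋` never exceeds `B` times its value at the anchor. -/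
def RatioBudgetFrom (b₀ B : ℝ) : Prop :=
  ∀ b : ℝ, b₀ ≤ b → 0 < weilOddGroundEnergy b →
    weilEvenGroundEnergy b * weilOddGroundEnergy b₀ ≤ B * (weilEvenGroundEnergy b₀ * weilOddGroundEnergy b)

/-- PROVED (`Iff.rfl`): at the anchor of record `b₀ = 2/3` the class IS the binder consumed by the four
`PfPersistenceRatioTransport` theorems. [folklore] -/
theorem ratioBudgetFrom_two_thirds_iff (B : ℝ) :
    RatioBudgetFrom (2 / 3) B ↔
      ∀ b : ℝ, 2 / 3 ≤ b → 0 < weilOddGroundEnergy b →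
        weilEvenGroundEnergy b * weilOddGroundEnergy (2 / 3) ≤
          B * (weilEvenGroundEnergy (2 / 3) * weilOddGroundEnergy b) :=
  Iff.rfl

/-- PROVED: the class is monotone in the budget when the anchor's even bottom is nonnegative
(`B ≤ B′ ⇒ RatioBudgetFrom b₀ B → RatioBudgetFrom b₀ B′`). [folklore] -/
theorem RatioBudgetFrom.mono {b₀ B B' : ℝ} (h : RatioBudgetFrom b₀ B) (hBB : B ≤ B')
    (hev : 0 ≤ weilEvenGroundEnergy b₀) : RatioBudgetFrom b₀ B' := fun b hb hodd =>
  (h b hb hodd).trans (mul_le_mul_of_nonneg_right hBB (mul_nonneg hev hodd.le))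

/-- PROVED (anchor consistency): at `b = b₀` itself the budget inequality holds for every `B ≥ 1` whenever
`0 ≤ ε₊(b₀)` and `0 < ε₋(b₀)` — only budgets `B < 1` can be refuted at the anchor. [folklore] -/
theorem ratioBudgetFrom_self_of_one_le {b₀ B : ℝ} (hB : 1 ≤ B) (hev : 0 ≤ weilEvenGroundEnergy b₀)
    (hodd : 0 < weilOddGroundEnergy b₀) :
    weilEvenGroundEnergy b₀ * weilOddGroundEnergy b₀ ≤ B * (weilEvenGroundEnergy b₀ * weilOddGroundEnergy b₀) := by
  nlinarith [mul_nonneg hev hodd.le]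

/-- RE-EXPORT (conditional theorem of 6fdca81f1d52): seed `B·ε₊(2/3) < ε₋(2/3)` + the class ⇒ even strictly
below odd at every `b ≥ 2/3` with positive odd bottom. [folklore] -/
theorem RatioBudgetFrom.even_lt_odd {B : ℝ} (h : RatioBudgetFrom (2 / 3) B)
    (hseed : B * weilEvenGroundEnergy (2 / 3) < weilOddGroundEnergy (2 / 3)) :
    ∀ b : ℝ, 2 / 3 ≤ b → 0 < weilOddGroundEnergy b → weilEvenGroundEnergy b < weilOddGroundEnergy b :=
  even_lt_odd_of_ratioBudget hseed h

/-- RE-EXPORT (conditional theorem of 6fdca81f1d52): under the class + seed, a parity tie at `b ≥ 2/3` forces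
the odd bottom (hence the ground energy) nonpositive there. [folklore] -/
theorem RatioBudgetFrom.odd_nonpos_of_parityTie {B : ℝ} (h : RatioBudgetFrom (2 / 3) B)
    (hseed : B * weilEvenGroundEnergy (2 / 3) < weilOddGroundEnergy (2 / 3)) {b : ℝ} (hb : 2 / 3 ≤ b)
    (htie : weilOddGroundEnergy b ≤ weilEvenGroundEnergy b) :
    weilOddGroundEnergy b ≤ 0 ∧ weilGroundEnergy b ≤ 0 :=
  odd_nonpos_of_parityTie_of_ratioBudget hseed h hb htie

/-- RE-EXPORT (conditional theorem of 6fdca81f1d52; RH is a HYPOTHESIS here, nothing about RH is claimed): class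
+ seed + RH ⇒ the three parity items. [folklore] -/
theorem RatioBudgetFrom.parity_of_riemannHypothesis {B : ℝ} (h : RatioBudgetFrom (2 / 3) B)
    (hseed : B * weilEvenGroundEnergy (2 / 3) < weilOddGroundEnergy (2 / 3)) (hRH : RiemannHypothesis) :
    NoParityCrossing ∧ GroundStateSimpleEven ∧ EvenWinsBeyondArch :=
  parity_of_ratioBudget_of_riemannHypothesis hseed h hRH

/-- RE-EXPORT (conditional theorem of 6fdca81f1d52): every budget `0 ≤ B < 50` is seed-admissible, so class + RH
⇒ the three parity items. [folklore] -/
theorem RatioBudgetFrom.parity_of_lt_fifty_of_riemannHypothesis {B : ℝ} (h : RatioBudgetFrom (2 / 3) B)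
    (hB0 : 0 ≤ B) (hB50 : B < 50) (hRH : RiemannHypothesis) :
    NoParityCrossing ∧ GroundStateSimpleEven ∧ EvenWinsBeyondArch :=
  parity_of_ratioBudget_lt_fifty_of_riemannHypothesis hB0 hB50 h hRH

end Summit.RiemannHypothesis.RiemannHypothesis.Theorems.PfPersistence

end
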